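/-
Copyright (c) 2026 the pub-hodgecm-mathlib formalisation cell (harness21).  Prover seat hodgecm-mathlib-K2E4-p10 (g6), Track B ∕ K2-LIT, h413 =
`stmt-HodgeConjecture-24833`, line `K2_E1_TraceFormulaBeta`, campaign «EIS-R7-BL-SPH-3», (RES) letter payer (P-orth), generic part (dealer K2E1-plan (g6) (89), 2026-09-04).
-/
import Summits.HodgeConjecture.HodgeConjecture.Theorems.K2E1CuspFormsMeanZeroSoftU                  -- ★ p859260 (this seat): `borelHeight_rightRelOut_mul`; brings ★ FILE A∕B, the cusp-condition dictionary, `continuous_borelHeight`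
import Summits.HodgeConjecture.HodgeConjecture.Theorems.K2E1TruncatedEisensteinExplicit            -- ★ (K2E4-p22 g0): `subsingleton_setOf_lt_borelHeight_out_mul`, `forall_arithmeticBorel_indicator`, `eisensteinSeriesU_eq_tsum_arithmeticBorelQuot`
import Summits.HodgeConjecture.HodgeConjecture.Theorems.K2E1BLEisensteinInWeightedSpaceU2Weights   -- ★ P7-C (K2E4-p23 g0): `supHeight_eq_ciSup_arithmetic`
import Summits.HodgeConjecture.HodgeConjecture.Theorems.K2E1BLHeckeOperatorWeightedU2             -- ★ P3-C (K2E1-p11): `bddAbove_range_borelHeight_arith_mul`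
import Summits.HodgeConjecture.HodgeConjecture.Theorems.K2E1BLHeckeOperatorHXU2                   -- ★ P3-C: `measurable_supHeight`
import Mathlib.Analysis.Analytic.Uniqueness
import Mathlib.Analysis.Complex.CauchyIntegral
import HarnessLib

/-!
# K2·E1 — `K2E1SphericalEisensteinResidueOrthogonalU` ((RES) payer (P-orth), generic part): LIMITS AND IDENTITY PRINCIPLE FOR `z ↦ ⟪w, F z⟫`; THE SIEGEL ONE-TERM BOUND
# `‖E(𝟙_{H>T}ψ)‖ ≤ M` AND THE SIEGEL INDICATOR `quotFun (E 𝟙_{H>T}) = 𝟙_{T<w₁}` ON `U(J_N)`, EVERY RANK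

Track B ∕ K2-LIT, crux h413 = `stmt-HodgeConjecture-24833`, route of record `HCCMUnconditional`; cell `hodgecm-mathlib`, squad K2, ENGINE E1, campaign EIS-R7-BL-SPH-3 (R31).  Prover seat
`hodgecm-mathlib-K2E4-p10` (g6); RE-KEY (89) of the dealer K2E1-plan (g6).  THEOREMS ONLY (no `def`, no `instance`, no notation, no named-fact hypothesis, no `sorry`); lane
`--supports stmt-HodgeConjecture-24833 --as helper` (count-neutral).  Closes no socket.  The generic half of the (P-orth) payer of ★ p859418 `hres_cm_three_of_letters`'s letter `horth`
(«the residue class `Fres = Res_T + κ·[𝟙_{T<w₁}]` is orthogonal to every cusp form»); the `N = 3` CM tube orthogonality and the head live in ★ `K2E1SphericalEisensteinResidueOrthogonalCMThree`.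
* §1 (any complex inner-product space `H`) `inner_eq_zero_of_tendsto` — a limit of vectors orthogonal to `w` is orthogonal to `w`; **`inner_eq_zero_of_differentiableOn`** — the identity
  principle for `z ↦ ⟪w, F z⟫` (`F` holomorphic on a preconnected open `D`, `⟪w, F z⟫ = 0` near one point ⟹ on all of `D`; Mathlib `AnalyticOnNhd.eqOn_zero_of_preconnected_of_eventuallyEq_zero`).
* §2 (`U(J_N)`, every rank, on the Siegel hypothesis `H(γg)H(g) ≤ 1` off `B(F)`, `T ≥ 1`) `tsum_enorm_indicator_lt_le` ∕ `norm_eisensteinSeriesU_indicator_lt_le` — the ONE-TERM BOUND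
  `‖E(𝟙_{H>T}·ψ)(y)‖ ≤ M` whenever `‖ψ‖ ≤ M` above `T` (at most one coset above the floor, ★ `subsingleton_setOf_lt_borelHeight_out_mul`); **`quotFun_eisensteinSeriesU_indicator_one`** —
  `quotFun (E 𝟙_{H>T}) = quotFun (t ↦ 𝟙[T < w₁[t⁻¹]])` (the Siegel indicator class `[𝟙_{T<w₁}]` of ★ p859494 IS an Eisenstein series; ★ `supHeight_eq_ciSup_arithmetic`, ★
  `bddAbove_range_borelHeight_arith_mul`); `memLp_quotFun_siegelIndicator` — its class lies in every `L^p(μ)` (`μ` finite).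
HONEST LABEL: HC_CM is proved only modulo the 7 printed citations (2 remaining named inputs: hLiu418 = `stmt-HodgeConjecture-24832`, h413 = `stmt-HodgeConjecture-24833`) until rung 0
closes; this file asserts no named fact and closes no socket.
References: [MoeglinWaldspurger1995] I.2.13, IV.1.11 · [Garrett2018] §2.10–§2.11 · [BernsteinLapid2019] §4 p. 10 · [Conway1978] IV §3 (identity theorem).
-/

set_option autoImplicit false
-- the mandated namespace repeats the single-problem summit's segment (`HodgeConjecture.HodgeConjecture`)
set_option linter.dupNamespace false

noncomputable section

open MeasureTheory Measure NumberField IsDedekindDomain Set Filter Topology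
open scoped ENNReal NNReal InnerProductSpace ComplexConjugate
open Literature.NumberTheory.Automorphic Literature.NumberTheory.Automorphic.UnitaryGroup AdelicGroupData
open Summit.HodgeConjecture.HodgeConjecture.Cruxes.H413.K2E1BorelEisensteinU
open Summit.HodgeConjecture.HodgeConjecture.Cruxes.H413.K2E1BorelCosetsDictionary (eisensteinSeriesU_eq_tsum_arithmeticBorelQuot)
open Summit.HodgeConjecture.HodgeConjecture.Cruxes.H413.K2E1TruncatedEisensteinExplicit (subsingleton_setOf_lt_borelHeight_out_mul forall_arithmeticBorel_indicator)
open Summit.HodgeConjecture.HodgeConjecture.Cruxes.H413.K2E1CuspFormsMeanZeroSoftU (borelHeight_rightRelOut_mul)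
open Summit.HodgeConjecture.HodgeConjecture.Cruxes.H413.K2E1BLBorelSpacesU2Defs
open Summit.HodgeConjecture.HodgeConjecture.Cruxes.H413.K2E1BLEisensteinInWeightedSpaceU2Weights (supHeight_eq_ciSup_arithmetic)
open Summit.HodgeConjecture.HodgeConjecture.Cruxes.H413.K2E1BLHeckeOperatorWeightedU2 (bddAbove_range_borelHeight_arith_mul)

namespace Summit.HodgeConjecture.HodgeConjecture.Cruxes.H413.K2E1SphericalEisensteinResidueOrthogonalU

/-! ## §1 Limits and the identity principle for `z ↦ ⟪w, F z⟫` -/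

section Hilbert

variable {H : Type*} [NormedAddCommGroup H] [InnerProductSpace ℂ H]

/-- **A LIMIT OF VECTORS ORTHOGONAL TO `w` IS ORTHOGONAL TO `w`** (continuity of the inner product). [folklore] -/
theorem inner_eq_zero_of_tendsto {α : Type*} {l : Filter α} [l.NeBot] {V : α → H} {v : H} (w : H) (hV : Tendsto V l (𝓝 v))
    (h0 : ∀ᶠ a in l, ⟪w, V a⟫_ℂ = 0) : ⟪w, v⟫_ℂ = 0 := by
  have h1 : Tendsto (fun a => ⟪w, V a⟫_ℂ) l (𝓝 ⟪w, v⟫_ℂ) := tendsto_const_nhds.inner hV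
  have h2 : Tendsto (fun a => ⟪w, V a⟫_ℂ) l (𝓝 0) := tendsto_const_nhds.congr' (h0.mono fun a ha => ha.symm)
  exact tendsto_nhds_unique h1 h2

/-- **THE IDENTITY PRINCIPLE FOR `z ↦ ⟪w, F z⟫`**: for `F : ℂ → H` holomorphic on a preconnected open `D` and `z₀ ∈ D`, if `⟪w, F z⟫ = 0` for `z` near `z₀` then `⟪w, F z⟫ = 0` on `D`
(the scalar function is analytic on `D`; Mathlib `AnalyticOnNhd.eqOn_zero_of_preconnected_of_eventuallyEq_zero`). [cite: Conway1978, IV §3 (identity theorem)] -/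
theorem inner_eq_zero_of_differentiableOn {F : ℂ → H} {D : Set ℂ} (hDo : IsOpen D) (hDc : IsPreconnected D) (hFd : DifferentiableOn ℂ F D)
    (w : H) {z₀ : ℂ} (hz₀ : z₀ ∈ D) (h0 : ∀ᶠ z in 𝓝 z₀, ⟪w, F z⟫_ℂ = 0) : ∀ z ∈ D, ⟪w, F z⟫_ℂ = 0 := by
  have hf : DifferentiableOn ℂ (fun z => ⟪w, F z⟫_ℂ) D := fun z hz =>
    ((innerSL ℂ w).differentiableAt).comp_differentiableWithinAt z (hFd z hz)
  have hA : AnalyticOnNhd ℂ (fun z => ⟪w, F z⟫_ℂ) D := hf.analyticOnNhd hDo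
  have h0' : (fun z => ⟪w, F z⟫_ℂ) =ᶠ[𝓝 z₀] 0 := h0.mono fun z hz => by
    show ⟪w, F z⟫_ℂ = (0 : ℂ → ℂ) z
    rw [hz, Pi.zero_apply]
  intro z hz
  have h := hA.eqOn_zero_of_preconnected_of_eventuallyEq_zero hDc hz₀ h0' hz
  rwa [Pi.zero_apply] at h

end Hilbert

/-! ## §2 The Siegel one-term bound and the Siegel indicator as an Eisenstein series, every rank -/

section Siegel

variable {F E : Type} [Field F] [NumberField F] [Field E] [NumberField E] [Algebra F E] {c : E ≃ₐ[F] E} {N : ℕ} [NeZero N]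

/-- **THE ONE-TERM BOUND, `ℝ≥0∞` FORM**: under the Siegel property (`H(γg)H(g) ≤ 1` off `B(F)`) and `T ≥ 1`, if `‖ψ g‖ ≤ M` whenever `H(g) > T`, then for every `y`
`Σ'_{q ∈ B(F)∖G(F)} ‖(𝟙_{H>T}ψ)(q̃ y)‖ₑ ≤ M` — at most one coset lies above the floor (★ `subsingleton_setOf_lt_borelHeight_out_mul`). [cite: Garrett2018, §2.10] [cite: MoeglinWaldspurger1995, I.2.13] -/
theorem tsum_enorm_indicator_lt_le
    (hSiegel : ∀ γ : (quasiSplit F E c N).arithmeticSubgroup, γ ∉ arithmeticBorel F E c N →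
      ∀ g : (quasiSplit F E c N).Adelic, borelHeight ((γ : (quasiSplit F E c N).Adelic) * g) * borelHeight g ≤ 1)
    {T : ℝ≥0} (hT : 1 ≤ T) {ψ : (quasiSplit F E c N).Adelic → ℂ} {M : ℝ} (hM0 : 0 ≤ M)
    (hM : ∀ g : (quasiSplit F E c N).Adelic, T < borelHeight g → ‖ψ g‖ ≤ M) (y : (quasiSplit F E c N).Adelic) :
    ∑' q : Quotient (QuotientGroup.rightRel (arithmeticBorel F E c N)),
        ‖({g : (quasiSplit F E c N).Adelic | T < borelHeight g}.indicator ψ) (((q.out : (quasiSplit F E c N).arithmeticSubgroup) : (quasiSplit F E c N).Adelic) * y)‖ₑ ≤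
      ENNReal.ofReal M := by
  have hsub := subsingleton_setOf_lt_borelHeight_out_mul hSiegel hT y
  have hterm : ∀ q : Quotient (QuotientGroup.rightRel (arithmeticBorel F E c N)),
      ‖({g : (quasiSplit F E c N).Adelic | T < borelHeight g}.indicator ψ) (((q.out : (quasiSplit F E c N).arithmeticSubgroup) : (quasiSplit F E c N).Adelic) * y)‖ₑ ≤
        ENNReal.ofReal M := fun q => by
    rw [← ofReal_norm]
    refine ENNReal.ofReal_le_ofReal ?_
    by_cases hq : (((q.out : (quasiSplit F E c N).arithmeticSubgroup) : (quasiSplit F E c N).Adelic) * y) ∈ {g : (quasiSplit F E c N).Adelic | T < borelHeight g}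
    · rw [Set.indicator_of_mem hq]
      exact hM _ hq
    · rw [Set.indicator_of_notMem hq, norm_zero]
      exact hM0
  have hzero : ∀ q : Quotient (QuotientGroup.rightRel (arithmeticBorel F E c N)),
      q ∉ {q : Quotient (QuotientGroup.rightRel (arithmeticBorel F E c N)) |
        T < borelHeight (((q.out : (quasiSplit F E c N).arithmeticSubgroup) : (quasiSplit F E c N).Adelic) * y)} →
      ‖({g : (quasiSplit F E c N).Adelic | T < borelHeight g}.indicator ψ) (((q.out : (quasiSplit F E c N).arithmeticSubgroup) : (quasiSplit F E c N).Adelic) * y)‖ₑ = 0 :=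
    fun q hq => by
    rw [Set.indicator_of_notMem (s := {g : (quasiSplit F E c N).Adelic | T < borelHeight g}) hq, enorm_zero]
  rcases hsub.eq_empty_or_singleton with h | ⟨q₀, hq₀⟩
  · rw [ENNReal.tsum_eq_zero.2 fun q => hzero q (by rw [h]; exact Set.notMem_empty q)]
    exact bot_le
  · rw [tsum_eq_single q₀ fun q hq => hzero q (by rw [hq₀]; exact hq)]
    exact hterm q₀

/-- **THE ONE-TERM BOUND FOR THE EISENSTEIN SERIES**: `‖E(𝟙_{H>T}·ψ)(y)‖ ≤ M` for every `y` (`ψ` left-`B(F)`-invariant with `‖ψ‖ ≤ M` above `T ≥ 1`). [cite: Garrett2018, §2.10] -/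
theorem norm_eisensteinSeriesU_indicator_lt_le
    (hSiegel : ∀ γ : (quasiSplit F E c N).arithmeticSubgroup, γ ∉ arithmeticBorel F E c N →
      ∀ g : (quasiSplit F E c N).Adelic, borelHeight ((γ : (quasiSplit F E c N).Adelic) * g) * borelHeight g ≤ 1)
    {T : ℝ≥0} (hT : 1 ≤ T) {ψ : (quasiSplit F E c N).Adelic → ℂ}
    (hψ : ∀ b ∈ arithmeticBorel F E c N, ∀ x : (quasiSplit F E c N).Adelic, ψ ((b : (quasiSplit F E c N).Adelic) * x) = ψ x)
    {M : ℝ} (hM0 : 0 ≤ M) (hM : ∀ g : (quasiSplit F E c N).Adelic, T < borelHeight g → ‖ψ g‖ ≤ M) (y : (quasiSplit F E c N).Adelic) :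
    ‖eisensteinSeriesU ({g : (quasiSplit F E c N).Adelic | T < borelHeight g}.indicator ψ) y‖ ≤ M := by
  rw [eisensteinSeriesU_eq_tsum_arithmeticBorelQuot (forall_arithmeticBorel_indicator hψ fun h => T < h) y, ← ENNReal.ofReal_le_ofReal_iff hM0,
    ofReal_norm]
  exact enorm_tsum_le_tsum_enorm.trans (tsum_enorm_indicator_lt_le hSiegel hT hM0 hM y)

/-- **THE SIEGEL INDICATOR IS AN EISENSTEIN SERIES**: on `𝔛`, `quotFun (E 𝟙_{H>T}) = quotFun (t ↦ 𝟙[T < w₁[t⁻¹]])` (`T ≥ 1`, Siegel property): at `x = [g]` the series counts the cosets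
`q` with `H(q̃ g⁻¹) > T` — one if `T < w₁(x) = sup_γ H(γ g⁻¹)` (★ `supHeight_eq_ciSup_arithmetic`, ★ `bddAbove_range_borelHeight_arith_mul`), none otherwise.
[cite: MoeglinWaldspurger1995, I.2.13] [cite: BernsteinLapid2019, §4 p. 10] -/
theorem quotFun_eisensteinSeriesU_indicator_one
    (hSiegel : ∀ γ : (quasiSplit F E c N).arithmeticSubgroup, γ ∉ arithmeticBorel F E c N →
      ∀ g : (quasiSplit F E c N).Adelic, borelHeight ((γ : (quasiSplit F E c N).Adelic) * g) * borelHeight g ≤ 1)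
    {T : ℝ≥0} (hT : 1 ≤ T) :
    (quasiSplit F E c N).quotFun (eisensteinSeriesU ({g : (quasiSplit F E c N).Adelic | T < borelHeight g}.indicator fun _ => (1 : ℂ))) =
      (quasiSplit F E c N).quotFun fun t => if T < supHeight F E c N ((quasiSplit F E c N).toAutomorphicQuotient t⁻¹) then (1 : ℂ) else 0 := by
  funext x
  change eisensteinSeriesU _ (Quotient.out (x : (quasiSplit F E c N).Adelic ⧸ (quasiSplit F E c N).quotientSubgroup))⁻¹ =
    (if T < supHeight F E c N ((quasiSplit F E c N).toAutomorphicQuotient (Quotient.out (x : (quasiSplit F E c N).Adelic ⧸ (quasiSplit F E c N).quotientSubgroup))⁻¹⁻¹) then (1 : ℂ) else 0)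
  rw [inv_inv, show (quasiSplit F E c N).toAutomorphicQuotient (Quotient.out (x : (quasiSplit F E c N).Adelic ⧸ (quasiSplit F E c N).quotientSubgroup)) = x from Quotient.out_eq _]
  set y : (quasiSplit F E c N).Adelic := (Quotient.out (x : (quasiSplit F E c N).Adelic ⧸ (quasiSplit F E c N).quotientSubgroup))⁻¹ with hy
  have h1B : ∀ b ∈ arithmeticBorel F E c N, ∀ x : (quasiSplit F E c N).Adelic, (fun _ : (quasiSplit F E c N).Adelic => (1 : ℂ)) ((b : (quasiSplit F E c N).Adelic) * x) =
      (fun _ : (quasiSplit F E c N).Adelic => (1 : ℂ)) x := fun _ _ _ => rfl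
  rw [eisensteinSeriesU_eq_tsum_arithmeticBorelQuot (forall_arithmeticBorel_indicator h1B fun h => T < h) y]
  have hiff : T < supHeight F E c N x ↔ ∃ γ : (quasiSplit F E c N).arithmeticSubgroup, T < borelHeight ((γ : (quasiSplit F E c N).Adelic) * y) := by
    rw [supHeight_eq_ciSup_arithmetic, lt_ciSup_iff (bddAbove_range_borelHeight_arith_mul _)]
  have hsub := subsingleton_setOf_lt_borelHeight_out_mul hSiegel hT y
  rcases hsub.eq_empty_or_singleton with h | ⟨q₀, hq₀⟩
  · -- no coset above the floor
    have hno : ¬ ∃ γ : (quasiSplit F E c N).arithmeticSubgroup, T < borelHeight ((γ : (quasiSplit F E c N).Adelic) * y) := by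
      rintro ⟨γ, hγ⟩
      have hmem : Quotient.mk (QuotientGroup.rightRel (arithmeticBorel F E c N)) γ ∈
          {q : Quotient (QuotientGroup.rightRel (arithmeticBorel F E c N)) |
            T < borelHeight (((q.out : (quasiSplit F E c N).arithmeticSubgroup) : (quasiSplit F E c N).Adelic) * y)} := by
        show T < borelHeight _
        rwa [borelHeight_rightRelOut_mul γ y]
      rw [h] at hmem
      exact hmem
    rw [if_neg (fun hx => hno (hiff.1 hx))]
    refine (tsum_congr fun q => ?_).trans tsum_zero
    refine Set.indicator_of_notMem (s := {g : (quasiSplit F E c N).Adelic | T < borelHeight g}) (fun hq => ?_) _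
    have hmem : q ∈ {q : Quotient (QuotientGroup.rightRel (arithmeticBorel F E c N)) |
        T < borelHeight (((q.out : (quasiSplit F E c N).arithmeticSubgroup) : (quasiSplit F E c N).Adelic) * y)} := hq
    rw [h] at hmem
    exact hmem
  · -- exactly one coset `q₀` above the floor
    have hq₀mem : q₀ ∈ {q : Quotient (QuotientGroup.rightRel (arithmeticBorel F E c N)) |
        T < borelHeight (((q.out : (quasiSplit F E c N).arithmeticSubgroup) : (quasiSplit F E c N).Adelic) * y)} := by
      rw [hq₀]; exact Set.mem_singleton q₀
    rw [tsum_eq_single q₀ fun q hq => Set.indicator_of_notMem (s := {g : (quasiSplit F E c N).Adelic | T < borelHeight g}) (fun hq' => hq ?_) _,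
      Set.indicator_of_mem (s := {g : (quasiSplit F E c N).Adelic | T < borelHeight g}) hq₀mem, if_pos (hiff.2 ⟨_, hq₀mem⟩)]
    have hmem : q ∈ {q : Quotient (QuotientGroup.rightRel (arithmeticBorel F E c N)) |
        T < borelHeight (((q.out : (quasiSplit F E c N).arithmeticSubgroup) : (quasiSplit F E c N).Adelic) * y)} := hq'
    rw [hq₀] at hmem
    exact hmem

/-- **THE SIEGEL INDICATOR CLASS LIES IN EVERY `L^p(μ)`** (`μ` finite): `quotFun (t ↦ 𝟙[T < w₁[t⁻¹]]) x = 𝟙[T < w₁ x]` is Borel (★ `measurable_supHeight`) and bounded by `1`.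
[cite: BernsteinLapid2019, §4 p. 10] -/
theorem memLp_quotFun_siegelIndicator (μ : Measure (quasiSplit F E c N).automorphicQuotient) [IsFiniteMeasure μ] (p : ℝ≥0∞) (T : ℝ≥0) :
    MemLp ((quasiSplit F E c N).quotFun fun t => if T < supHeight F E c N ((quasiSplit F E c N).toAutomorphicQuotient t⁻¹) then (1 : ℂ) else 0) p μ := by
  have heq : ((quasiSplit F E c N).quotFun fun t => if T < supHeight F E c N ((quasiSplit F E c N).toAutomorphicQuotient t⁻¹) then (1 : ℂ) else 0) =
      fun x => if T < supHeight F E c N x then (1 : ℂ) else 0 := by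
    funext x
    change (if T < supHeight F E c N ((quasiSplit F E c N).toAutomorphicQuotient
      (Quotient.out (x : (quasiSplit F E c N).Adelic ⧸ (quasiSplit F E c N).quotientSubgroup))⁻¹⁻¹) then (1 : ℂ) else 0) = _
    rw [inv_inv, show (quasiSplit F E c N).toAutomorphicQuotient (Quotient.out (x : (quasiSplit F E c N).Adelic ⧸ (quasiSplit F E c N).quotientSubgroup)) = x from Quotient.out_eq _]
  rw [heq]
  refine MemLp.of_bound (Measurable.ite (measurableSet_lt measurable_const K2E1BLHeckeOperatorHXU2.measurable_supHeight) measurable_const measurable_const).aestronglyMeasurable 1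
    (ae_of_all _ fun x => ?_)
  split_ifs <;> simp

end Siegel

end Summit.HodgeConjecture.HodgeConjecture.Cruxes.H413.K2E1SphericalEisensteinResidueOrthogonalU

end
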